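import Mathlib
import HarnessLib
import Summits.QuantumFields.YangMills.Theorems.ComplexCouplingChannelContinuumLegGivenGapProductToUniformDefs
import Summits.QuantumFields.YangMills.Theorems.MirrorModularBoostsHypercubicLimitFunctionalBoundPlanes

/-!
# `ContinuumLegGivenGap` (stmt-QuantumFields-15828), line `alternating-curvature-arrays`: `stub_ptuAssembly`, kit — the elementary arithmetic of the assembly

Support file for `stub_ptuAssembly` (the assembly `piece₁ → piece₂ → piece₃ → ((PB) ⇒ (UUVB))` of the Whitney system
`…ProductToUniformDefs`).  Pure real arithmetic, no analysis:

* `ptuKit_shape_le_factorial` (registered anchor) — the SHAPE of (UUVB): for `Ω ≥ 1`,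
  `Ω^{p+1} (p+1)^{E(p+1)} ≤ α(Ω,E) · (p!)^{E+2}` with `α(Ω,E) = Ω e^Ω (2e)^E e^{(2e)^E}` (`xⁿ/n! ≤ eˣ` and the landed
  `HypercubicLimit.CouplingResponse.succ_pow_succ_le`);
* `ptuKit_level_sum_le` — the two geometric series over the Whitney levels: for `a > 0` and ANY finite set of levels,
  `∑ₘ min(ℓₘ, ℓₘ⁻¹) ≤ 3`, `ℓₘ = a · cellSide m = a 3^m/2`;
* `ptuKit_ptuR_le` — the near radius is linear in the arity: `ptuR p ≤ 13824 (p+1)`; `ptuKit_two_mul_add_one_pow_four_le`.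

[folklore]
-/

set_option autoImplicit false

noncomputable section

namespace Summit.QuantumFields.YangMills.Theorems.ContinuumLegGivenGap

open scoped BigOperators
open Summit.QuantumFields.YangMills.Theorems.ContinuumLegGivenGap.AlternatingArrays (cellSide)

/-! ## §1 The factorial shape -/

/-- `Ω^{p+1} ≤ Ω e^Ω p!` for `Ω ≥ 0`. [folklore] -/
theorem ptuKit_pow_succ_le_exp_mul_factorial {Ω : ℝ} (hΩ : 0 ≤ Ω) (p : ℕ) :
    Ω ^ (p + 1) ≤ Ω * Real.exp Ω * (p.factorial : ℝ) := by
  have h := Real.pow_div_factorial_le_exp Ω hΩ p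
  have hf : (0 : ℝ) < (p.factorial : ℝ) := by exact_mod_cast Nat.factorial_pos _
  rw [div_le_iff₀ hf] at h
  calc Ω ^ (p + 1) = Ω * Ω ^ p := by ring
    _ ≤ Ω * (Real.exp Ω * (p.factorial : ℝ)) := mul_le_mul_of_nonneg_left h hΩ
    _ = Ω * Real.exp Ω * (p.factorial : ℝ) := by ring

/-- **The shape of (UUVB)** (registered anchor): for `Ω ≥ 1` and all `E p`,
`Ω^{p+1} (p+1)^{E(p+1)} ≤ (Ω e^Ω (2e)^E e^{(2e)^E}) · (p!)^{E+2}`. [folklore] -/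
theorem ptuKit_shape_le_factorial : ∀ (Ω : ℝ) (E p : ℕ), 1 ≤ Ω →
    Ω ^ (p + 1) * ((p : ℝ) + 1) ^ (E * (p + 1)) ≤
      (Ω * Real.exp Ω * (2 * Real.exp 1) ^ E * Real.exp ((2 * Real.exp 1) ^ E)) * (p.factorial : ℝ) ^ (E + 2) := by
  intro Ω E p hΩ
  have hΩ0 : 0 ≤ Ω := zero_le_one.trans hΩ
  have hf0 : (0 : ℝ) ≤ (p.factorial : ℝ) := Nat.cast_nonneg _
  set q : ℝ := (2 * Real.exp 1) ^ E with hq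
  have hq0 : 0 ≤ q := by positivity
  -- `(p+1)^{E(p+1)} ≤ q^{p+1} (p!)^E`
  have h1 : ((p : ℝ) + 1) ^ (E * (p + 1)) ≤ q ^ (p + 1) * (p.factorial : ℝ) ^ E := by
    rw [mul_comm E, pow_mul]
    calc (((p : ℝ) + 1) ^ (p + 1)) ^ E ≤ ((2 * Real.exp 1) ^ (p + 1) * (p.factorial : ℝ)) ^ E :=
          pow_le_pow_left₀ (by positivity)
            (Summit.QuantumFields.YangMills.Cruxes.HypercubicLimit.CouplingResponse.succ_pow_succ_le p) E
      _ = q ^ (p + 1) * (p.factorial : ℝ) ^ E := by rw [hq, mul_pow, ← pow_mul, ← pow_mul, mul_comm (p + 1) E]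
  -- `q^{p+1} ≤ q e^q p!`, `Ω^{p+1} ≤ Ω e^Ω p!`
  have h2 := ptuKit_pow_succ_le_exp_mul_factorial hq0 p
  have h3 := ptuKit_pow_succ_le_exp_mul_factorial hΩ0 p
  calc Ω ^ (p + 1) * ((p : ℝ) + 1) ^ (E * (p + 1))
      ≤ (Ω * Real.exp Ω * (p.factorial : ℝ)) * (q ^ (p + 1) * (p.factorial : ℝ) ^ E) :=
        mul_le_mul h3 h1 (by positivity) (by positivity)
    _ ≤ (Ω * Real.exp Ω * (p.factorial : ℝ)) * ((q * Real.exp q * (p.factorial : ℝ)) * (p.factorial : ℝ) ^ E) := by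
        refine mul_le_mul_of_nonneg_left (mul_le_mul_of_nonneg_right h2 (by positivity)) (by positivity)
    _ = (Ω * Real.exp Ω * q * Real.exp q) * (p.factorial : ℝ) ^ (E + 2) := by ring
    _ = (Ω * Real.exp Ω * (2 * Real.exp 1) ^ E * Real.exp ((2 * Real.exp 1) ^ E)) * (p.factorial : ℝ) ^ (E + 2) := by
        rw [hq]

/-- Three shaped terms add up to one shaped term: for `x, y, z ≥ 0` and exponents `≤ E`,
`x^{p+1}(p+1)^{E₁(p+1)} + y^{p+1}(p+1)^{E₂(p+1)} + z^{p+1}(p+1)^{E₃(p+1)} ≤ (3(x+y+z))^{p+1} (p+1)^{E(p+1)}`. [folklore] -/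
theorem ptuKit_shape_add_three {x y z : ℝ} (hx : 0 ≤ x) (hy : 0 ≤ y) (hz : 0 ≤ z) {E₁ E₂ E₃ E : ℕ}
    (h₁ : E₁ ≤ E) (h₂ : E₂ ≤ E) (h₃ : E₃ ≤ E) (p : ℕ) :
    x ^ (p + 1) * ((p : ℝ) + 1) ^ (E₁ * (p + 1)) + y ^ (p + 1) * ((p : ℝ) + 1) ^ (E₂ * (p + 1)) +
        z ^ (p + 1) * ((p : ℝ) + 1) ^ (E₃ * (p + 1)) ≤
      (3 * (x + y + z)) ^ (p + 1) * ((p : ℝ) + 1) ^ (E * (p + 1)) := by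
  have hp1 : (1 : ℝ) ≤ (p : ℝ) + 1 := by linarith [(Nat.cast_nonneg p : (0 : ℝ) ≤ p)]
  have hs : 0 ≤ x + y + z := by positivity
  have hpow : ∀ {w : ℝ} {Ew : ℕ}, 0 ≤ w → w ≤ x + y + z → Ew ≤ E →
      w ^ (p + 1) * ((p : ℝ) + 1) ^ (Ew * (p + 1)) ≤ (x + y + z) ^ (p + 1) * ((p : ℝ) + 1) ^ (E * (p + 1)) :=
    fun hw hwle hE => mul_le_mul (pow_le_pow_left₀ hw hwle _)
      (pow_le_pow_right₀ hp1 (Nat.mul_le_mul_right _ hE)) (by positivity) (by positivity)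
  have hX := hpow hx (by linarith) h₁
  have hY := hpow hy (by linarith) h₂
  have hZ := hpow hz (by linarith) h₃
  have h3 : (3 : ℝ) * (x + y + z) ^ (p + 1) ≤ (3 * (x + y + z)) ^ (p + 1) := by
    rw [mul_pow]
    refine mul_le_mul_of_nonneg_right ?_ (by positivity)
    calc (3 : ℝ) = 3 ^ 1 := (pow_one _).symm
      _ ≤ 3 ^ (p + 1) := pow_le_pow_right₀ (by norm_num) (by omega)
  calc _ ≤ 3 * ((x + y + z) ^ (p + 1) * ((p : ℝ) + 1) ^ (E * (p + 1))) := by linarith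
    _ = (3 * (x + y + z) ^ (p + 1)) * ((p : ℝ) + 1) ^ (E * (p + 1)) := by ring
    _ ≤ _ := mul_le_mul_of_nonneg_right h3 (by positivity)

/-! ## §2 The geometric series over the Whitney levels -/

/-- The physical cell side is positive. [folklore] -/
theorem ptuKit_ell_pos {a : ℝ} (ha : 0 < a) (m : ℕ) : 0 < a * cellSide m := by
  unfold cellSide; positivity

/-- Ratio of cell sides: `ℓ_{m} = ℓ_{n} · 3^{m-n}` for `n ≤ m`. [folklore] -/
theorem ptuKit_ell_eq_mul_pow (a : ℝ) {m n : ℕ} (h : n ≤ m) : a * cellSide m = a * cellSide n * 3 ^ (m - n) := by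
  unfold cellSide
  rw [← Nat.add_sub_cancel' h, pow_add, Nat.add_sub_cancel_left]
  ring

/-- The SMALL levels: `∑_{m ∈ S, ℓₘ ≤ 1} ℓₘ ≤ 3/2`. [folklore] -/
theorem ptuKit_sum_small_le {a : ℝ} (ha : 0 < a) (S : Finset ℕ) :
    ∑ m ∈ S.filter (fun m => a * cellSide m ≤ 1), a * cellSide m ≤ 3 / 2 := by
  set T := S.filter (fun m => a * cellSide m ≤ 1) with hT
  by_cases hne : T.Nonempty
  · set M := T.max' hne with hM
    have hMmem : M ∈ T := T.max'_mem hne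
    have hM1 : a * cellSide M ≤ 1 := (Finset.mem_filter.1 hMmem).2
    have hsub : T ⊆ Finset.range (M + 1) := fun m hm => Finset.mem_range.2 (Nat.lt_succ_of_le (T.le_max' m hm))
    calc ∑ m ∈ T, a * cellSide m ≤ ∑ m ∈ Finset.range (M + 1), a * cellSide m :=
          Finset.sum_le_sum_of_subset_of_nonneg hsub fun m _ _ => (ptuKit_ell_pos ha m).le
      _ = a / 2 * ∑ m ∈ Finset.range (M + 1), (3 : ℝ) ^ m := by
          rw [Finset.mul_sum]; refine Finset.sum_congr rfl fun m _ => ?_; unfold cellSide; ring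
      _ = a / 2 * ((3 ^ (M + 1) - 1) / 2) := by rw [geom_sum_eq (by norm_num : (3 : ℝ) ≠ 1)]; norm_num
      _ ≤ a / 2 * (3 ^ (M + 1) / 2) := by gcongr; linarith
      _ = 3 / 2 * (a * cellSide M) := by unfold cellSide; rw [pow_succ]; ring
      _ ≤ 3 / 2 := by nlinarith
  · rw [Finset.not_nonempty_iff_eq_empty.1 hne, Finset.sum_empty]; norm_num

/-- The LARGE levels: `∑_{m ∈ S, ℓₘ > 1} ℓₘ⁻¹ ≤ 3/2`. [folklore] -/
theorem ptuKit_sum_large_le {a : ℝ} (ha : 0 < a) (S : Finset ℕ) :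
    ∑ m ∈ S.filter (fun m => ¬ a * cellSide m ≤ 1), (a * cellSide m)⁻¹ ≤ 3 / 2 := by
  set T := S.filter (fun m => ¬ a * cellSide m ≤ 1) with hT
  by_cases hne : T.Nonempty
  · set M := T.min' hne with hM
    have hMmem : M ∈ T := T.min'_mem hne
    have hM1 : 1 < a * cellSide M := not_le.1 (Finset.mem_filter.1 hMmem).2
    have hℓM := ptuKit_ell_pos ha M
    -- reindex by `j = m - M` and compare with the geometric series of ratio `1/3`
    have hterm : ∀ m ∈ T, (a * cellSide m)⁻¹ = (a * cellSide M)⁻¹ * ((1 : ℝ) / 3) ^ (m - M) := by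
      intro m hm
      rw [ptuKit_ell_eq_mul_pow a (T.min'_le m hm), mul_inv, one_div, inv_pow]
    rw [Finset.sum_congr rfl hterm, ← Finset.mul_sum]
    have hgeo : ∑ m ∈ T, ((1 : ℝ) / 3) ^ (m - M) ≤ ∑' j : ℕ, ((1 : ℝ) / 3) ^ j := by
      rw [← Finset.sum_image (f := fun j : ℕ => ((1 : ℝ) / 3) ^ j) (s := T) (g := fun m => m - M)
        (fun m hm m' hm' h => by
          have h1 := T.min'_le m hm; have h2 := T.min'_le m' hm'
          simp only at h; omega)]
      exact Summable.sum_le_tsum _ (fun j _ => by positivity)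
        (summable_geometric_of_lt_one (by norm_num) (by norm_num))
    rw [tsum_geometric_of_lt_one (by norm_num) (by norm_num)] at hgeo
    have hinv : (a * cellSide M)⁻¹ ≤ 1 := inv_le_one_of_one_le₀ hM1.le
    calc (a * cellSide M)⁻¹ * ∑ m ∈ T, ((1 : ℝ) / 3) ^ (m - M) ≤ 1 * (1 - 1 / 3)⁻¹ :=
          mul_le_mul hinv hgeo (Finset.sum_nonneg fun m _ => by positivity) zero_le_one
      _ = 3 / 2 := by norm_num
  · rw [Finset.not_nonempty_iff_eq_empty.1 hne, Finset.sum_empty]; norm_num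

/-- **The level series**: `∑_{m ∈ S} min(ℓₘ, ℓₘ⁻¹) ≤ 3` for every finite set of levels. [folklore] -/
theorem ptuKit_level_sum_le {a : ℝ} (ha : 0 < a) (S : Finset ℕ) :
    ∑ m ∈ S, min (a * cellSide m) (a * cellSide m)⁻¹ ≤ 3 := by
  rw [← Finset.sum_filter_add_sum_filter_not S (fun m => a * cellSide m ≤ 1)]
  have h1 : ∑ m ∈ S.filter (fun m => a * cellSide m ≤ 1), min (a * cellSide m) (a * cellSide m)⁻¹ ≤ 3 / 2 :=
    (Finset.sum_le_sum fun m _ => min_le_left _ _).trans (ptuKit_sum_small_le ha S)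
  have h2 : ∑ m ∈ S.filter (fun m => ¬ a * cellSide m ≤ 1), min (a * cellSide m) (a * cellSide m)⁻¹ ≤ 3 / 2 :=
    (Finset.sum_le_sum fun m _ => min_le_right _ _).trans (ptuKit_sum_large_le ha S)
  linarith

/-! ## §3 Numerics of the Whitney system -/

/-- The near radius is linear in the arity: `ptuR p ≤ 13824 (p+1)`. [folklore] -/
theorem ptuKit_ptuR_le (p : ℕ) : (ptuR p : ℝ) ≤ 13824 * ((p : ℝ) + 1) := by
  have h1 : 3 ^ Nat.log 3 (64 * (2 * p + 1)) ≤ 64 * (2 * p + 1) := Nat.pow_log_le_self 3 (by omega)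
  have h2 : ptuR p ≤ 13824 * (p + 1) := by
    unfold ptuR ptuM0
    rw [pow_succ]
    nlinarith
  exact_mod_cast h2

/-- `(2p+1)^4 ≤ 81 (p+1)^4`. [folklore] -/
theorem ptuKit_two_mul_add_one_pow_four_le (p : ℕ) : (2 * (p : ℝ) + 1) ^ 4 ≤ 81 * ((p : ℝ) + 1) ^ 4 := by
  have h : 2 * (p : ℝ) + 1 ≤ 3 * ((p : ℝ) + 1) := by linarith [(Nat.cast_nonneg p : (0 : ℝ) ≤ p)]
  calc (2 * (p : ℝ) + 1) ^ 4 ≤ (3 * ((p : ℝ) + 1)) ^ 4 := pow_le_pow_left₀ (by positivity) h 4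
    _ = 81 * ((p : ℝ) + 1) ^ 4 := by ring

/-- Monotonicity used throughout: `x ≤ y`, `1 ≤ y`, `i ≤ j` give `x^i ≤ y^j` for `x ≥ 0`. [folklore] -/
theorem ptuKit_pow_le_pow {x y : ℝ} (hx : 0 ≤ x) (hxy : x ≤ y) (hy : 1 ≤ y) {i j : ℕ} (hij : i ≤ j) :
    x ^ i ≤ y ^ j :=
  (pow_le_pow_left₀ hx hxy i).trans (pow_le_pow_right₀ hy hij)

end Summit.QuantumFields.YangMills.Theorems.ContinuumLegGivenGap

end
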